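/-
Copyright: statement-level skeleton of a published paper (lit-balaban cell, reader/typer r15). No proof claims beyond
what the kernel checks below.
-/
import Mathlib
import Literature.MathematicalPhysics.QuantumFieldTheory.Balaban1983to89.B1Sect3Statements
import Literature.MathematicalPhysics.QuantumFieldTheory.Balaban1983to89.B3Sect1Statements

/-!
# B3 — T. Bałaban, *(Higgs)₂,₃ quantum fields in a finite volume. III. Renormalization*, CMP **88** (1983) 411–445,
Sect. 1 pp. 412, 418–419: the perturbative truncation (1.5) and the counterterm bookkeeping (1.26), (1.29), (1.30)

statement-level skeleton of published theorems with citation tags; proofs where landed; nothing here is a claim about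
the Yang–Mills mass gap

Source: held text `paper:balaban1983-higgs-2-3-quantum-fields-finite-volume` (journal page = PDF page + 410); displays
read on the ×2 renders `pub-balaban/b2b-balaban-ref1/pages/1983-cmp88-higgs23-III/1983-cmp88-higgs23-III-p002, p008,
p009-x2.png` (pp. 412, 418, 419).  SKELETON rows B3.Eq1.5, B3.Eq1.26, B3.Eq1.29-1.30 of
`HOME/lit-balaban-r15/ROWS-B3.md` (fold owner r15).  Companions: `B3Sect1Statements` ((1.25), (1.27), (1.28) —
`eq128` is the splitting mechanism reused for (1.26)), `B3MultiscaleFields` ((1.1)–(1.3)), r12's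
`B1Sect3Statements` ((I.3.36)/(I.3.62) `pertSum362`, the double Taylor sum reused for (1.5)).

## What is typed here, and how

* **(1.5)** p. 412, verbatim: *"The interaction after k steps is given by the formula 𝒫^{(k)}(Ω₁, A^{(k)}, φ) =
  Σ_{1≦α+β≦n̄} (1/(α!β!)) (∂^{α+β}/∂e′^α∂λ′^β E_k(e′, λ′, Ω, A^{(k)}, φ))|_{e′=λ′=0}. (1.5)"* — `pert15`: the truncated
  double Taylor sum of the generating function `E = E_k(·, ·, Ω, A^{(k)}, φ)` (the fields fixed) WITHOUT the
  `(α, β) = (0, 0)` term and without powers of the couplings (in (1.4) the physical couplings `e(L^kε)`, `λ(L^kε)` sit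
  inside `E_k`; the bookkeeping parameters `e′, λ′` are set to `1`); PROVED to be r12's `B1Sect3Statements.pertSum362`
  (I (3.36)/(3.62)) at `e = λ = 1` minus the value `E(0, 0)` (`pert15_eq_pertSum362_sub`).  The generating function
  (1.4) itself (a Gaussian functional integral) is row B3.Eq1.4 and is not modelled here.
  **v1.1 (append-only; §(1.5)R below): `pert15R`, the ONE-SIDED READING in `λ′`** — the decl of record for
  instantiation at the CONCRETE generating function of (1.4) (typer's `B3Eq14AuxFunction.Data14.auxE`): that `E_k`
  is `−log` of a Bochner integral which is `0` for `λ′ < 0` under Lean's conventions (the quartic weight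
  `exp[+|λ′|λ(L^kε)Σ η^d|φ′|⁴]` is not integrable; typer g24 `B3Eq15OneSidedInteraction.auxE_eq_zero_of_neg`), so its
  two-sided `λ′`-derivatives at `0` vanish and `pert15` of it keeps only the `β = 0` terms — no `λ`-vertex (1.6) at
  all — whereas the print's perturbation expansion (pp. 412–413) is the RIGHT Taylor series at `λ′ = 0⁺`.  `pert15R`
  takes `iteratedDerivWithin β · (Set.Ici 0) 0` in `λ′` (inner) and `iteratedDeriv α · 0` in `e′` (outer) — the
  convention of r01's `B1Sect1Statements.ModelData.e1R` ((I.1.13)) and r12's `B1Sect3Statements.pertSum362R`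
  ((I.3.62)); PROVED: `pert15R = pertSum362R(·) 1 1 n̄ − E(0,0)` (`pert15R_eq_pertSum362R_sub`), dependence on `E`
  only through `λ′ ≥ 0` (`pert15R_congr_Ici`), agreement with `pert15` for `E` that is `C^{n̄}` in `λ′` at `0`
  two-sidedly (`pert15R_eq_pert15`), insensitivity to a constant shift of `E` (`pert15R_const_add`: the `(0,0)` term is
  absent from (1.5)); the `β = 0` summands of the two readings agree by `B1Sect3Statements.pertSum362R_term_beta_zero`.  The v1.0 `pert15` and its theorems are kept verbatim (generic and correct as a schema; the
  located defect is only its instantiation at a generating function undefined for `λ′ < 0`).  The concrete instance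
  `interaction15R` (= `pert15R` of `auxE`, by `rfl` on the summands) is typer's `B3Eq15OneSidedInteraction`.
* **(1.26)** p. 418, verbatim: *"More exactly we have δm² = δm²_fin(x) + δm²_K(x), E₁ = E_fin + E_K, (1.26) where
  δm²_K(x), E_K are given by the same expressions (same graphs) as δm², E₁, but with propagators G^ε_K, G^ε_K(0)
  instead of C^ε, C^ε_0, and δm²_fin(x), E_fin are convergent as ε → 0."* — typed reading (as for (1.28) in
  `B3Sect1Statements.eq128`): a graph expression is a map `E` MULTILINEAR in the propagators of its lines; by (1.25)
  every propagator is `C = G_K + R` with a regular piece `R`; `δm²_K := E(G_K, …, G_K)` and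
  `δm²_fin := E(C, …, C) − δm²_K` (`finPart`), which is (1.26) (`eq126`), and `δm²_fin` = the sum over the proper
  subsets of lines carrying `G_K` of the mixed terms, each containing at least one regular factor `R`
  (`finPart_eq`, from `eq128`).  The convergence claim ("convergent as ε → 0") is a consequence of Proposition 1 and
  is NOT typed.
* **(1.29)**, **(1.30)** p. 419, verbatim: *"We get counterterms δm²_k(e(L^kε)g_k, λ(L^kε), Ω₁, x),
  E_k(e(L^kε)g_k, λ(L^kε), Ω₁), and we define δm²(e′, g_k, λ′, Ω₁, x)(L^kε)² = δm²_fin(e′, λ′, x)(L^kε)² +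
  δm²_{K,k}(e′, λ′, x)(L^kε)² + δm²_k(e′e(L^kε)g_k, λ′λ(L^kε), Ω₁, x), (1.29)  E₁(e′, g_k, λ′, Ω₁) = E_fin(e′, λ′) +
  E_{K,k}(e′, λ′) + E_k(e′e(L^kε)g_k, λ′λ(L^kε), Ω₁), (1.30) the dependence on e′, λ′ is obtained by replacing e, λ
  by e′e, λ′λ."* — `dm2Total` and `E1Total`: the assembled counterterms of (1.4) as functions of the bookkeeping
  couplings `(e′, λ′)`, given the three pieces (finite, `K,k`-tail, scale-`k`) as supplied functions; the scale-`k`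
  pieces take the POSITION-DEPENDENT coupling `x ↦ e′e(L^kε)g_k(x)` (p. 419: *"functions g_k multiplying each
  leg of the vector field (or each coupling constant e)"*) and the set `Ω₁`.  The graph expansions (1.23)–(1.24)
  defining the pieces are rows B3.Eq1.23/B3.Eq1.24 (not modelled).
-/

open scoped BigOperators

namespace Literature.MathematicalPhysics.QuantumFieldTheory.Balaban1983to89.B3Sect1Counterterms

/-! ## (1.5) — the interaction after k steps as a truncated Taylor sum of the generating function -/

section Eq15

/-- The index set of (1.5): pairs `(α, β)` with `1 ≤ α + β ≤ n̄`. [cite: Balaban1983Higgs3, (1.5) p.412] -/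
def idx15 (nbar : ℕ) : Finset (ℕ × ℕ) :=
  ((Finset.range (nbar + 1) ×ˢ Finset.range (nbar + 1)).filter fun ab => ab.1 + ab.2 ≤ nbar).filter
    fun ab => 1 ≤ ab.1 + ab.2

/-- **(1.5)** p. 412 [PDF 2], verbatim: *"The interaction after k steps is given by the formula
𝒫^{(k)}(Ω₁, A^{(k)}, φ) = Σ_{1≦α+β≦n̄} (1/(α!β!)) (∂^{α+β}/∂e′^α∂λ′^β E_k(e′, λ′, Ω, A^{(k)}, φ))|_{e′=λ′=0}. (1.5)"* —
for the generating function `E : ℝ → ℝ → ℝ`, `(e′, λ′) ↦ E_k(e′, λ′, Ω, A^{(k)}, φ)` at fixed fields; mixed partials as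
iterated one-variable derivatives (as in `B1Sect3Statements.pertSum362`). [cite: Balaban1983Higgs3, (1.5) p.412] -/
noncomputable def pert15 (E : ℝ → ℝ → ℝ) (nbar : ℕ) : ℝ :=
  ∑ ab ∈ idx15 nbar,
    1 / ((ab.1.factorial : ℝ) * (ab.2.factorial : ℝ)) *
      iteratedDeriv ab.1 (fun e' => iteratedDeriv ab.2 (fun l' => E e' l') 0) 0

/-- The index set of (1.5) is the index set `0 ≤ α + β ≤ n̄` of (I.3.36)/(I.3.62) with `(0, 0)` removed.
[cite: Balaban1983Higgs3, (1.5) p.412] -/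
theorem idx15_eq_erase (nbar : ℕ) :
    idx15 nbar = ((Finset.range (nbar + 1) ×ˢ Finset.range (nbar + 1)).filter
      fun ab => ab.1 + ab.2 ≤ nbar).erase (0, 0) := by
  ext ⟨a, b⟩
  simp only [idx15, Finset.mem_filter, Finset.mem_erase, Finset.mem_product, Finset.mem_range, ne_eq,
    Prod.mk.injEq]
  omega

/-- **(1.5) versus (I.3.36).**  `𝒫^{(k)} = [the perturbative sum (I.3.62) of E_k at e = λ = 1] − E_k(0, 0)`: the
(0, 0) Taylor term is the value of the generating function and all other terms coincide (no powers of the couplings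
appear in (1.5) because the running couplings are inside `E_k`, cf. (1.4)).  PROVED. [cite: Balaban1983Higgs3, (1.5) p.412] -/
theorem pert15_eq_pertSum362_sub (E : ℝ → ℝ → ℝ) (nbar : ℕ) :
    pert15 E nbar = B1Sect3Statements.pertSum362 E 1 1 nbar - E 0 0 := by
  have hmem : ((0 : ℕ), (0 : ℕ)) ∈ ((Finset.range (nbar + 1) ×ˢ Finset.range (nbar + 1)).filter
      fun ab => ab.1 + ab.2 ≤ nbar) := by
    simp
  rw [pert15, idx15_eq_erase, B1Sect3Statements.pertSum362, ← Finset.sum_erase_add _ _ hmem]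
  simp only [one_pow, mul_one, Nat.factorial_zero, Nat.cast_one, iteratedDeriv_zero, one_div, inv_one, one_mul]
  ring

/-- With `n̄ = 0` the sum (1.5) is empty. [cite: Balaban1983Higgs3, (1.5) p.412] -/
theorem pert15_zero (E : ℝ → ℝ → ℝ) : pert15 E 0 = 0 := by
  have h : idx15 0 = ∅ := by
    ext ⟨a, b⟩
    simp only [idx15, Finset.mem_filter, Finset.mem_product, Finset.mem_range, Finset.notMem_empty, iff_false,
      not_and, not_le]
    omega
  simp [pert15, h]

end Eq15

/-! ## (1.5)R (v1.1) — the ONE-SIDED READING in `λ′`: decl of record for instantiation at the concrete `E_k` of (1.4),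
aligned with r01's repaired (I.1.13) `B1Sect1Statements.ModelData.e1R` and r12's (I.3.62) `B1Sect3Statements.pertSum362R`;
the v1.0 two-sided `pert15` above is kept verbatim -/

section Eq15R

/-- **(1.5)** p. 412 [PDF 2], ONE-SIDED READING (v1.1 decl of record for concrete generating functions), verbatim:
*"The interaction after k steps is given by the formula 𝒫^{(k)}(Ω₁, A^{(k)}, φ) = Σ_{1≦α+β≦n̄} (1/(α!β!))
(∂^{α+β}/∂e′^α∂λ′^β E_k(e′, λ′, Ω, A^{(k)}, φ))|_{e′=λ′=0}. (1.5)"* — for a generating function `E : ℝ → ℝ → ℝ` (fields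
fixed), the `λ′`-DERIVATIVES TAKEN FROM THE RIGHT AT `0⁺` (`iteratedDerivWithin β · (Set.Ici 0) 0`: the concrete `E_k` of
(1.4) is `−log` of a functional integral with the weight `exp[−λ′λ(L^kε)Σ_{x∈Ω₁}η^d|φ′(x)|⁴]`, which exists for `λ′ ≥ 0`
only, and the perturbation expansion pp. 412–413 is its Taylor series there), the `e′`-derivatives two-sided
(`iteratedDeriv α · 0`), inner variable `λ′`, outer `e′` (the convention of `B1Sect1Statements.ModelData.e1R` and
`B1Sect3Statements.pertSum362R`).  The typer's concrete `B3Eq15OneSidedInteraction.Data14.interaction15R n̄ A φ` is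
`pert15R (fun e′ λ′ ↦ auxE e′ λ′ A φ) n̄` summand by summand. [cite: Balaban1983Higgs3, (1.5) p.412] -/
noncomputable def pert15R (E : ℝ → ℝ → ℝ) (nbar : ℕ) : ℝ :=
  ∑ ab ∈ idx15 nbar,
    1 / ((ab.1.factorial : ℝ) * (ab.2.factorial : ℝ)) *
      iteratedDeriv ab.1 (fun e' => iteratedDerivWithin ab.2 (fun l' => E e' l') (Set.Ici 0) 0) 0

/-- **(1.5) versus (I.3.62), one-sided reading.**  `𝒫^{(k)} = [the one-sided perturbative sum (I.3.62) of E_k at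
e = λ = 1] − E_k(0, 0)` — the one-sided twin of `pert15_eq_pertSum362_sub` (the `(0, 0)` term of (I.3.62) is the value
of the generating function; the order-`0` right derivative is the value).  PROVED. [cite: Balaban1983Higgs3, (1.5) p.412] -/
theorem pert15R_eq_pertSum362R_sub (E : ℝ → ℝ → ℝ) (nbar : ℕ) :
    pert15R E nbar = B1Sect3Statements.pertSum362R E 1 1 nbar - E 0 0 := by
  have hmem : ((0 : ℕ), (0 : ℕ)) ∈ ((Finset.range (nbar + 1) ×ˢ Finset.range (nbar + 1)).filter
      fun ab => ab.1 + ab.2 ≤ nbar) := by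
    simp
  rw [pert15R, idx15_eq_erase, B1Sect3Statements.pertSum362R, ← Finset.sum_erase_add _ _ hmem]
  simp only [one_pow, mul_one, Nat.factorial_zero, Nat.cast_one, iteratedDerivWithin_zero, iteratedDeriv_zero, one_div,
    inv_one, one_mul]
  ring

/-- With `n̄ = 0` the one-sided sum (1.5) is empty. [cite: Balaban1983Higgs3, (1.5) p.412] -/
theorem pert15R_zero (E : ℝ → ℝ → ℝ) : pert15R E 0 = 0 := by
  have h : idx15 0 = ∅ := by
    ext ⟨a, b⟩
    simp only [idx15, Finset.mem_filter, Finset.mem_product, Finset.mem_range, Finset.notMem_empty, iff_false,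
      not_and, not_le]
    omega
  simp [pert15R, h]

/-- **What the one-sided reading buys**: (1.5) depends on the generating function ONLY through its values on the
physical half-plane `λ′ ≥ 0` (all `e′`) — two generating functions agreeing there have the same interaction `𝒫^{(k)}`,
whatever values they carry on `λ′ < 0` (where the functional integral (1.4) diverges).  From
`B1Sect3Statements.pertSum362R_congr_Ici`. [cite: Balaban1983Higgs3, (1.5) p.412] -/
theorem pert15R_congr_Ici {E E' : ℝ → ℝ → ℝ} (h : ∀ e' l', 0 ≤ l' → E e' l' = E' e' l') (nbar : ℕ) :
    pert15R E nbar = pert15R E' nbar := by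
  rw [pert15R_eq_pertSum362R_sub, pert15R_eq_pertSum362R_sub, B1Sect3Statements.pertSum362R_congr_Ici h,
    h 0 0 le_rfl]

/-- **Agreement of the two readings under two-sided smoothness**: if for every `e′` the function `λ′ ↦ E(e′, λ′)` is
`C^β` at `λ′ = 0` for all `β ≦ n̄` (e.g. any `E` jointly `C^∞` on `ℝ²` — the generality in which `pert15` is a correct
schema), then `pert15R E = pert15 E`.  From `B1Sect3Statements.pertSum362R_eq_pertSum362`.
[cite: Balaban1983Higgs3, (1.5) p.412] -/
theorem pert15R_eq_pert15 {E : ℝ → ℝ → ℝ} {nbar : ℕ}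
    (h : ∀ e', ∀ β ≤ nbar, ContDiffAt ℝ β (fun l' => E e' l') 0) :
    pert15R E nbar = pert15 E nbar := by
  rw [pert15R_eq_pertSum362R_sub, pert15_eq_pertSum362_sub, B1Sect3Statements.pertSum362R_eq_pertSum362 h]

-- The `β = 0` summands (pure-`e′` derivatives) of the two readings agree with no hypothesis — this is
-- `B1Sect3Statements.pertSum362R_term_beta_zero` verbatim (not restated here); the readings differ exactly in the
-- `β ≥ 1` (`λ`-vertex) terms.

/-- **(1.5) does not see the vacuum constant**: a constant shift of the generating function leaves `𝒫^{(k)}` unchanged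
(the `(α, β) = (0, 0)` term is absent from (1.5) and every higher coefficient of a constant vanishes) — consistent with
p. 412's normalization of `E_k` by `−log` of a ratio-free integral: additive constants in `E_k` (vacuum energies) drop
out of the interaction.  From `B1Sect3Statements.pertSum362R_const_add`. [cite: Balaban1983Higgs3, (1.5) p.412] -/
theorem pert15R_const_add (c : ℝ) (E : ℝ → ℝ → ℝ) (nbar : ℕ) :
    pert15R (fun e' l' => c + E e' l') nbar = pert15R E nbar := by
  rw [pert15R_eq_pertSum362R_sub, pert15R_eq_pertSum362R_sub, B1Sect3Statements.pertSum362R_const_add]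
  ring

end Eq15R

/-! ## (1.26) — `δm² = δm²_fin + δm²_K`, `E₁ = E_fin + E_K` -/

section Eq126

variable {S ι V W : Type*} [CommSemiring S] [AddCommGroup V] [AddCommGroup W] [Module S V] [Module S W]

/-- The FINITE part of (1.26): for a graph expression `E` multilinear in the propagators of its lines `ι`, with the
physical propagator `C = G_K + R` on every line ((1.25): `R` = the regular piece `a_K(L^Kε)^{−2}G^ε_K(0)P_KC^ε_0`),
`δm²_fin := δm² − δm²_K = E(C, …, C) − E(G_K, …, G_K)` (p. 418: *"δm²_K(x), E_K are given by the same expressions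
(same graphs) as δm², E₁, but with propagators G^ε_K, G^ε_K(0) instead of C^ε, C^ε_0"*). [cite: Balaban1983Higgs3, (1.26) p.418] -/
def finPart (E : MultilinearMap S (fun _ : ι => V) W) (GK R : ι → V) : W :=
  E (GK + R) - E GK

/-- **(1.26)** p. 418 [PDF 8], verbatim: *"More exactly we have δm² = δm²_fin(x) + δm²_K(x), E₁ = E_fin + E_K, (1.26)"*
— for every graph expression `E` (multilinear in its lines' propagators) evaluated at `C = G_K + R`. PROVED (the
definition of the split). [cite: Balaban1983Higgs3, (1.26) p.418] -/
theorem eq126 (E : MultilinearMap S (fun _ : ι => V) W) (GK R : ι → V) :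
    E (GK + R) = finPart E GK R + E GK := by
  simp [finPart]

/-- The finite part collects exactly the terms with AT LEAST ONE regular factor: substituting `C = G_K + R` on every
line and expanding multilinearly (`B3Sect1Statements.eq128`), `δm²_fin = Σ_{s ⊊ lines} E(s-piecewise(G_K, R))`
(`s` = the lines still carrying `G_K`).  This is the typed content of *"only a finite error is made by considering
propagators G^ε_K instead of C^ε"* (p. 418) at the level of the expansion; the convergence as ε → 0 is NOT asserted.
PROVED. [cite: Balaban1983Higgs3, (1.26) p.418] -/
theorem finPart_eq [Fintype ι] [DecidableEq ι] (E : MultilinearMap S (fun _ : ι => V) W) (GK R : ι → V) :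
    finPart E GK R = ∑ s ∈ (Finset.univ : Finset (Finset ι)).erase Finset.univ, E (s.piecewise GK R) := by
  rw [finPart, B3Sect1Statements.eq128 E GK R]
  abel

/-- (1.26) composed with (1.28): `δm² = δm²_fin + δm²_{K,k} + δm²_k` — with `G_K = G_k + G_{K,k}` on every line
((1.27)), the three-term split whose pieces enter (1.29)/(1.30). PROVED (bookkeeping). [cite: Balaban1983Higgs3, (1.26)–(1.28) p.418] -/
theorem eq126_eq128 [Fintype ι] [DecidableEq ι] (E : MultilinearMap S (fun _ : ι => V) W) (Gk GKk R : ι → V) :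
    E (Gk + GKk + R)
      = finPart E (Gk + GKk) R
        + (∑ s ∈ (Finset.univ : Finset (Finset ι)).erase Finset.univ, E (s.piecewise Gk GKk))
        + E Gk := by
  rw [eq126 E (Gk + GKk) R, B3Sect1Statements.eq128 E Gk GKk]
  abel

end Eq126

/-! ## (1.29), (1.30) — the counterterms of (1.4) assembled from their pieces -/

section Eq129

variable {X : Type*}

/-- **(1.29)** p. 419 [PDF 9], verbatim: *"δm²(e′, g_k, λ′, Ω₁, x)(L^kε)² = δm²_fin(e′, λ′, x)(L^kε)² +
δm²_{K,k}(e′, λ′, x)(L^kε)² + δm²_k(e′e(L^kε)g_k, λ′λ(L^kε), Ω₁, x), (1.29) … the dependence on e′, λ′ is obtained by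
replacing e, λ by e′e, λ′λ."* — the VALUE of the left side (the mass counterterm of (1.4) times `(L^kε)²`) assembled
from the supplied pieces: `dfin`, `dKk` = δm²_fin, δm²_{K,k} as functions of `(e′, λ′, x)`; `dk` = δm²_k, taking the
position-dependent coupling `x ↦ e′e(L^kε)g_k(x)` (p. 419: *"functions g_k multiplying … each coupling constant e"*),
the quartic coupling and the set `Ω₁`; `ℓ = L^kε`, `eRun = e(L^kε)`, `lamRun = λ(L^kε)`. [cite: Balaban1983Higgs3, (1.29) p.419] -/
def dm2Total (ℓ eRun lamRun : ℝ) (dfin dKk : ℝ → ℝ → X → ℝ) (dk : (X → ℝ) → ℝ → Finset X → X → ℝ)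
    (g : X → ℝ) (Ω₁ : Finset X) (e' lam' : ℝ) (x : X) : ℝ :=
  dfin e' lam' x * ℓ ^ 2 + dKk e' lam' x * ℓ ^ 2 + dk (fun y => e' * eRun * g y) (lam' * lamRun) Ω₁ x

/-- **(1.30)** p. 419 [PDF 9], verbatim: *"E₁(e′, g_k, λ′, Ω₁) = E_fin(e′, λ′) + E_{K,k}(e′, λ′) +
E_k(e′e(L^kε)g_k, λ′λ(L^kε), Ω₁), (1.30)"* — the vacuum-energy counterterm of (1.4) assembled from its pieces
(`Efin`, `EKk`, `Ek` supplied; conventions as in `dm2Total`). [cite: Balaban1983Higgs3, (1.30) p.419] -/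
def E1Total (eRun lamRun : ℝ) (Efin EKk : ℝ → ℝ → ℝ) (Ek : (X → ℝ) → ℝ → Finset X → ℝ) (g : X → ℝ)
    (Ω₁ : Finset X) (e' lam' : ℝ) : ℝ :=
  Efin e' lam' + EKk e' lam' + Ek (fun y => e' * eRun * g y) (lam' * lamRun) Ω₁

/-- At `e′ = λ′ = 0` the scale-`k` pieces are taken at zero couplings (the point at which (1.5) differentiates).
[cite: Balaban1983Higgs3, (1.29) p.419] -/
theorem dm2Total_zero (ℓ eRun lamRun : ℝ) (dfin dKk : ℝ → ℝ → X → ℝ)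
    (dk : (X → ℝ) → ℝ → Finset X → X → ℝ) (g : X → ℝ) (Ω₁ : Finset X) (x : X) :
    dm2Total ℓ eRun lamRun dfin dKk dk g Ω₁ 0 0 x
      = dfin 0 0 x * ℓ ^ 2 + dKk 0 0 x * ℓ ^ 2 + dk (fun _ => 0) 0 Ω₁ x := by
  simp [dm2Total]

/-- Where the cut-off `g_k` equals `1` (p. 412: *"g_k(x) = 1 if dist(x, ∂Ω₁) ≥ M"*) the position-dependent coupling
of the scale-`k` piece is the constant `e′e(L^kε)`. [cite: Balaban1983Higgs3, (1.29) p.419] -/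
theorem dm2Total_of_g_eq_one (ℓ eRun lamRun : ℝ) (dfin dKk : ℝ → ℝ → X → ℝ)
    (dk : (X → ℝ) → ℝ → Finset X → X → ℝ) (g : X → ℝ) (hg : ∀ y, g y = 1) (Ω₁ : Finset X) (e' lam' : ℝ)
    (x : X) :
    dm2Total ℓ eRun lamRun dfin dKk dk g Ω₁ e' lam' x
      = dfin e' lam' x * ℓ ^ 2 + dKk e' lam' x * ℓ ^ 2 + dk (fun _ => e' * eRun) (lam' * lamRun) Ω₁ x := by
  simp [dm2Total, hg]

/-- (1.29) and (1.30) share the substitution `(e, λ) ↦ (e′e(L^kε)g_k, λ′λ(L^kε))`; at `e′ = 1`, `λ′ = 1` it is the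
physical localized coupling. [cite: Balaban1983Higgs3, (1.30) p.419] -/
theorem E1Total_one_one (eRun lamRun : ℝ) (Efin EKk : ℝ → ℝ → ℝ) (Ek : (X → ℝ) → ℝ → Finset X → ℝ)
    (g : X → ℝ) (Ω₁ : Finset X) :
    E1Total eRun lamRun Efin EKk Ek g Ω₁ 1 1 = Efin 1 1 + EKk 1 1 + Ek (fun y => eRun * g y) lamRun Ω₁ := by
  simp [E1Total]

end Eq129

end Literature.MathematicalPhysics.QuantumFieldTheory.Balaban1983to89.B3Sect1Counterterms
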